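import Literature.NumberTheory.Sieve.LinearEquationsInPrimesNilObstruction
import Mathlib.Geometry.Manifold.Algebra.LieGroup
import Mathlib.AlgebraicTopology.FundamentalGroupoid.SimplyConnected
import Mathlib.Topology.Homotopy.Product
import Mathlib.Topology.Homeomorph.Lemmas
import HarnessLib

/-!
# Linear equations in primes: products of nilmanifolds (Green–Tao 2010, Def. 8.1, App. E)

Trunk T-SIEVE (`Literature/NumberTheory/Sieve`), fifth file of the App. E / §11 programme in
the inline decomposition of `Literature.NumberTheory.Sieve.GreenTao2010_gowersUniformity`
(B. Green, T. Tao, *Linear equations in primes*, Ann. of Math. 171 (2010), Thm. 7.2). For the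
level `s = 2` of Thm. 7.2 "we need only consider nilmanifolds which are products of Heisenberg
examples" (Remark after Lemma E.9); `…HeisenbergNilmanifold.lean` gives the Heisenberg
nilmanifold with Lemma E.9 verified by hand, and this file closes the class under binary
products:

* `Nilmanifold.prod X Y : Nilmanifold s` — the product `(G × G')/(Γ × Γ')` of two `s`-step
  nilmanifolds (Def. 8.1): `G × G'` as a Lie group modelled on `𝓘(ℝ, E × E')` (Mathlib's product
  Lie group, transported along `𝓘(ℝ, E × E') = 𝓘(ℝ, E) × 𝓘(ℝ, E')`, `isManifold_prod`,
  `lieGroup_prod`), simply connected (`π₁(X × Y) = π₁ X × π₁ Y`), `s`-step nilpotent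
  (`lowerCentralSeries` of a product), `Γ × Γ'` discrete with compact quotient, and the max
  metric pulled back along the homeomorphism `(G × G')/(Γ × Γ') ≃ₜ G/Γ × G'/Γ'`
  (`quotientProdHomeo`, a continuous bijection from a compact to a Hausdorff space);
* `Nilmanifold.isRational_prod` — Lemma E.9 (rationality of the lower central series, the
  hypothesis of Cor. 11.6 in `…NilObstruction.lean`) is preserved by products, since
  `(G × G')_j = G_j × G'_j`;
* `Nilmanifold.GreenTao2010_nilObstructionAt_prod` — hence Cor. 11.6 for products of rational
  nilmanifolds, in particular for all finite products of Heisenberg nilmanifolds and circles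
  (`Nilmanifold.ofLE circle`), unconditionally.

## References

* B. Green, T. Tao, *Linear equations in primes*, Ann. of Math. (2) 171 (2010), 1753–1850
  (arXiv:math/0606088): Def. 8.1, Prop. 8.4 (`GI(2)` with products of Heisenberg nilmanifolds),
  Cor. 11.6, App. E (Remark after Lemma E.9).
-/

noncomputable section

open scoped Manifold ContDiff

namespace Literature.NumberTheory.Sieve

/-- A product of simply connected spaces is simply connected (path classes in `Y × Z` are
determined by their two projections; Hatcher, Prop. 1.12). A private copy of
`Literature.Topology.FourManifolds.simplyConnectedSpace_prod`, to keep the imports of this series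
light. [folklore] -/
private theorem simplyConnectedSpace_prod_aux {Y Z : Type*} [TopologicalSpace Y]
    [TopologicalSpace Z] [SimplyConnectedSpace Y] [SimplyConnectedSpace Z] :
    SimplyConnectedSpace (Y × Z) := by
  rw [simply_connected_iff_paths_homotopic]
  refine ⟨inferInstance, ?_⟩
  rintro ⟨a₁, b₁⟩ ⟨a₂, b₂⟩
  refine ⟨fun p q => ?_⟩
  rw [← Path.Homotopic.prod_projLeft_projRight p, ← Path.Homotopic.prod_projLeft_projRight q,
    Subsingleton.elim (Path.Homotopic.projLeft p) (Path.Homotopic.projLeft q),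
    Subsingleton.elim (Path.Homotopic.projRight p) (Path.Homotopic.projRight q)]

namespace Nilmanifold

open HostKra

variable {s : ℕ} (X Y : Nilmanifold s)

/-! ### The product Lie group `G × G'` modelled on `E × E'` -/

/-- `G × G'` is charted on `E × E'` (Mathlib's product charted space, on the model `E × E'` rather
than `ModelProd E E'`). [folklore] -/
instance instChartedSpaceProd : ChartedSpace (X.E × Y.E) (X.G × Y.G) :=
  inferInstanceAs (ChartedSpace (ModelProd X.E Y.E) (X.G × Y.G))

/-- `G × G'` is a smooth manifold modelled on `𝓘(ℝ, E × E') = 𝓘(ℝ, E) × 𝓘(ℝ, E')`. [folklore] -/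
theorem isManifold_prod : IsManifold 𝓘(ℝ, X.E × Y.E) ∞ (X.G × Y.G) := by
  rw [modelWithCornersSelf_prod]
  exact inferInstanceAs (IsManifold (𝓘(ℝ, X.E).prod 𝓘(ℝ, Y.E)) ∞ (X.G × Y.G))

/-- `G × G'` is a Lie group modelled on `𝓘(ℝ, E × E')`. [folklore] -/
theorem lieGroup_prod : LieGroup 𝓘(ℝ, X.E × Y.E) ∞ (X.G × Y.G) := by
  rw [modelWithCornersSelf_prod]
  exact inferInstanceAs (LieGroup (𝓘(ℝ, X.E).prod 𝓘(ℝ, Y.E)) ∞ (X.G × Y.G))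

/-- `G × G'` is `s`-step nilpotent. [folklore] -/
theorem lowerCentralSeries_prod_eq_bot :
    (⊤ : Subgroup (X.G × Y.G)).lowerCentralSeries s = ⊥ := by
  rw [Subgroup.top_lowerCentralSeries_prod, X.lowerCentralSeries_eq_bot, Y.lowerCentralSeries_eq_bot,
    Subgroup.bot_prod_bot]

/-- `Γ × Γ'` is discrete. [folklore] -/
instance instDiscreteTopologyProd : DiscreteTopology (X.Γ.prod Y.Γ) :=
  DiscreteTopology.of_continuous_injective
    (f := fun p : X.Γ.prod Y.Γ => ((⟨p.1.1, p.2.1⟩ : X.Γ), (⟨p.1.2, p.2.2⟩ : Y.Γ)))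
    ((continuous_fst.comp continuous_subtype_val).subtype_mk _ |>.prodMk
      ((continuous_snd.comp continuous_subtype_val).subtype_mk _))
    (by
      rintro ⟨⟨a, b⟩, hab⟩ ⟨⟨a', b'⟩, hab'⟩ h
      simp only [Prod.mk.injEq, Subtype.mk.injEq] at h
      exact Subtype.ext (Prod.ext h.1 h.2))

/-- A compact transversal of `Γ` in `G` (from the compactness of `G/Γ`). [folklore] -/
theorem exists_compact_transversal_top :
    ∃ K : Set X.G, IsCompact K ∧ ∀ y : X.G, ∃ x ∈ K, x⁻¹ * y ∈ X.Γ := by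
  obtain ⟨K, hKc, -, hK⟩ := X.isRationalAt_zero
  exact ⟨K, hKc, fun y => hK y (by rw [lcs_zero]; exact Subgroup.mem_top y)⟩

/-- `(G × G')/(Γ × Γ')` is compact (image of the product of compact transversals). [folklore] -/
instance instCompactSpaceProdQuotient : CompactSpace ((X.G × Y.G) ⧸ X.Γ.prod Y.Γ) := by
  obtain ⟨K, hKc, hK⟩ := X.exists_compact_transversal_top
  obtain ⟨K', hKc', hK'⟩ := Y.exists_compact_transversal_top
  refine ⟨?_⟩
  have e : (QuotientGroup.mk : X.G × Y.G → (X.G × Y.G) ⧸ X.Γ.prod Y.Γ) '' (K ×ˢ K') = Set.univ := by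
    apply Set.eq_univ_of_forall
    intro q
    obtain ⟨⟨g, g'⟩, rfl⟩ := QuotientGroup.mk_surjective q
    obtain ⟨x, hx, hxg⟩ := hK g
    obtain ⟨x', hx', hxg'⟩ := hK' g'
    refine ⟨(x, x'), ⟨hx, hx'⟩, ?_⟩
    rw [QuotientGroup.eq]
    exact ⟨by simpa using hxg, by simpa using hxg'⟩
  rw [← e]
  exact (hKc.prod hKc').image QuotientGroup.continuous_mk

/-- The comparison map `(G × G')/(Γ × Γ') → G/Γ × G'/Γ'`. [folklore] -/
def quotientProdMap : (X.G × Y.G) ⧸ X.Γ.prod Y.Γ → (X.G ⧸ X.Γ) × (Y.G ⧸ Y.Γ) :=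
  Quotient.lift (s := QuotientGroup.leftRel (X.Γ.prod Y.Γ))
    (fun p => ((p.1 : X.G ⧸ X.Γ), (p.2 : Y.G ⧸ Y.Γ)))
    (by
      intro p q hpq
      have hpq' : p⁻¹ * q ∈ X.Γ.prod Y.Γ := QuotientGroup.leftRel_apply.mp hpq
      exact Prod.ext (QuotientGroup.eq.mpr hpq'.1) (QuotientGroup.eq.mpr hpq'.2))

/-- The comparison map on cosets. [folklore] -/
theorem quotientProdMap_mk (g : X.G) (g' : Y.G) :
    quotientProdMap X Y (QuotientGroup.mk (g, g')) = ((g : X.G ⧸ X.Γ), (g' : Y.G ⧸ Y.Γ)) := rfl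

/-- The comparison map is continuous. [folklore] -/
theorem continuous_quotientProdMap : Continuous (quotientProdMap X Y) := by
  refine Continuous.quotient_lift ?_ _
  exact (QuotientGroup.continuous_mk.comp continuous_fst).prodMk
    (QuotientGroup.continuous_mk.comp continuous_snd)

/-- The comparison map is a bijection. [folklore] -/
theorem bijective_quotientProdMap : Function.Bijective (quotientProdMap X Y) := by
  constructor
  · intro p q hpq
    obtain ⟨⟨g, g'⟩, rfl⟩ := QuotientGroup.mk_surjective p
    obtain ⟨⟨h, h'⟩, rfl⟩ := QuotientGroup.mk_surjective q
    rw [quotientProdMap_mk, quotientProdMap_mk, Prod.mk.injEq, QuotientGroup.eq, QuotientGroup.eq]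
      at hpq
    rw [QuotientGroup.eq]
    exact ⟨hpq.1, hpq.2⟩
  · rintro ⟨a, b⟩
    obtain ⟨g, rfl⟩ := QuotientGroup.mk_surjective a
    obtain ⟨g', rfl⟩ := QuotientGroup.mk_surjective b
    exact ⟨QuotientGroup.mk (g, g'), rfl⟩

/-- **`(G × G')/(Γ × Γ') ≃ₜ G/Γ × G'/Γ'`** (a continuous bijection from a compact space to a
Hausdorff one). [folklore] -/
def quotientProdHomeo : (X.G × Y.G) ⧸ X.Γ.prod Y.Γ ≃ₜ (X.G ⧸ X.Γ) × (Y.G ⧸ Y.Γ) :=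
  (continuous_quotientProdMap X Y).homeoOfEquivCompactToT2
    (f := Equiv.ofBijective _ (bijective_quotientProdMap X Y))

/-- The homeomorphism is the comparison map. [folklore] -/
theorem quotientProdHomeo_apply (q : (X.G × Y.G) ⧸ X.Γ.prod Y.Γ) :
    quotientProdHomeo X Y q = quotientProdMap X Y q := rfl

/-- The product metric `max(d_{G/Γ}, d_{G'/Γ'})`, pulled back to `(G × G')/(Γ × Γ')`.
[cite: GreenTao2010, §8 (metrics on nilmanifolds are arbitrary)] -/
def prodDist (p q : (X.G × Y.G) ⧸ X.Γ.prod Y.Γ) : ℝ :=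
  max (X.dist (quotientProdMap X Y p).1 (quotientProdMap X Y q).1)
    (Y.dist (quotientProdMap X Y p).2 (quotientProdMap X Y q).2)

/-- **The product nilmanifold** `(G × G')/(Γ × Γ')` of two `s`-step nilmanifolds, with the
(pulled-back) max metric: again an `s`-step nilmanifold in the sense of Def. 8.1. ("we need only
consider nilmanifolds which are products of Heisenberg examples"; products of filtered
nilmanifolds are used throughout Green–Tao–Ziegler.) [cite: GreenTao2010, Def. 8.1 and App. E, Remark after Lemma E.9] -/
def prod : Nilmanifold s :=
  letI := X.isManifold_prod Y
  letI := X.lieGroup_prod Y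
  letI : SimplyConnectedSpace (X.G × Y.G) := simplyConnectedSpace_prod_aux
  letI mX : MetricSpace (X.G ⧸ X.Γ) := X.metricSpace
  letI mY : MetricSpace (Y.G ⧸ Y.Γ) := Y.metricSpace
  { E := X.E × Y.E
    G := X.G × Y.G
    lowerCentralSeries_eq_bot := X.lowerCentralSeries_prod_eq_bot Y
    Γ := X.Γ.prod Y.Γ
    dist := prodDist X Y
    dist_self := fun p => by simp [prodDist, X.dist_self, Y.dist_self]
    dist_comm := fun p q => by rw [prodDist, prodDist, X.dist_comm, Y.dist_comm]
    dist_triangle := fun p q r => by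
      unfold prodDist
      refine max_le ?_ ?_
      · exact (X.dist_triangle _ _ _).trans (add_le_add (le_max_left _ _) (le_max_left _ _))
      · exact (Y.dist_triangle _ _ _).trans (add_le_add (le_max_right _ _) (le_max_right _ _))
    eq_of_dist_eq_zero := fun p q h => by
      apply (bijective_quotientProdMap X Y).1
      have h1 : X.dist (quotientProdMap X Y p).1 (quotientProdMap X Y q).1 = 0 :=
        le_antisymm ((le_max_left _ _).trans_eq h) (X.dist_nonneg _ _)
      have h2 : Y.dist (quotientProdMap X Y p).2 (quotientProdMap X Y q).2 = 0 :=
        le_antisymm ((le_max_right _ _).trans_eq h) (Y.dist_nonneg _ _)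
      exact Prod.ext (X.eq_of_dist_eq_zero _ _ h1) (Y.eq_of_dist_eq_zero _ _ h2)
    isOpen_iff := fun U => by
      -- transport through the homeomorphism to the max metric on `G/Γ × G'/Γ'`
      have hd : ∀ p q, prodDist X Y p q =
          Dist.dist (quotientProdHomeo X Y p) (quotientProdHomeo X Y q) := by
        intro p q
        rw [quotientProdHomeo_apply, quotientProdHomeo_apply, Prod.dist_eq]
        rfl
      rw [← (quotientProdHomeo X Y).isOpen_image, Metric.isOpen_iff]
      constructor
      · intro h p hp
        obtain ⟨ε, hε, hball⟩ := h _ ⟨p, hp, rfl⟩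
        refine ⟨ε, hε, fun q hq => ?_⟩
        have : quotientProdHomeo X Y q ∈ quotientProdHomeo X Y '' U :=
          hball (Metric.mem_ball'.mpr (by rw [← hd]; exact hq))
        obtain ⟨q', hq', hqq'⟩ := this
        rwa [← (quotientProdHomeo X Y).injective hqq']
      · intro h z hz
        obtain ⟨p, hp, rfl⟩ := hz
        obtain ⟨ε, hε, hball⟩ := h p hp
        refine ⟨ε, hε, fun w hw => ?_⟩
        obtain ⟨q, rfl⟩ := (quotientProdHomeo X Y).surjective w
        refine ⟨q, hball q ?_, rfl⟩
        rw [hd]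
        exact Metric.mem_ball'.mp hw }

/-! ### Rationality of the product -/

/-- The lower central series of a product is the product of the lower central series. [folklore] -/
theorem lcs_prod (j : ℕ) : lcs (X.G × Y.G) j = (lcs X.G j).prod (lcs Y.G j) := by
  rcases j with _ | j
  · rw [lcs_zero, lcs_zero, lcs_zero, Subgroup.top_prod_top]
  · rw [lcs_succ, lcs_succ, lcs_succ, Subgroup.top_lowerCentralSeries_prod]

/-- **Lemma E.9 is preserved by products**: if `Γ ∩ G_j` and `Γ' ∩ G'_j` are cocompact in `G_j`,
`G'_j`, then so is `(Γ × Γ') ∩ (G × G')_j = (Γ ∩ G_j) × (Γ' ∩ G'_j)` in `(G × G')_j = G_j × G'_j`.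
[folklore] -/
theorem isRational_prod (hX : X.IsRational) (hY : Y.IsRational) : (X.prod Y).IsRational := by
  intro j
  obtain ⟨K, hKc, hKG, hK⟩ := hX j
  obtain ⟨K', hKc', hKG', hK'⟩ := hY j
  show RationalAt (lcs (X.G × Y.G)) (X.Γ.prod Y.Γ) j
  rw [RationalAt, lcs_prod]
  refine ⟨K ×ˢ K', hKc.prod hKc', ?_, ?_⟩
  · rintro ⟨a, b⟩ ⟨ha, hb⟩
    exact ⟨hKG ha, hKG' hb⟩
  · rintro ⟨y, y'⟩ ⟨hy, hy'⟩
    obtain ⟨x, hx, hxy⟩ := hK y hy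
    obtain ⟨x', hx', hxy'⟩ := hK' y' hy'
    exact ⟨(x, x'), ⟨hx, hx'⟩, ⟨by simpa using hxy, by simpa using hxy'⟩⟩

/-- **Cor. 11.6 for products of rational nilmanifolds** (e.g. products of Heisenberg nilmanifolds
and circles), unconditionally in the factors' rationality. [cite: GreenTao2010, Cor. 11.6 and App. E, Remark after Lemma E.9] -/
theorem GreenTao2010_nilObstructionAt_prod (hX : X.IsRational) (hY : Y.IsRational) (M : ℝ) :
    GreenTao2010_nilObstructionAt s (X.prod Y) M :=
  GreenTao2010_nilObstructionAt_of_isRational _ (X.isRational_prod Y hX hY) M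

end Nilmanifold

end Literature.NumberTheory.Sieve
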